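import Summits.KontsevichZagierPeriods.KontsevichZagierPeriods.Theses.AttractorUnfolding
import Summits.KontsevichZagierPeriods.KontsevichZagierPeriods.Theorems.InverseLandauTateLiftingLowDimAlgSector
import Literature.Analysis.Fourier.TrigPolySmallBall

/-!
# `PointResidue` (stmt-KontsevichZagierPeriods-11364, route AttractorUnfolding) — proof

The item: for complex constants `c, p, a` and a real `s` with algebraic real and imaginary parts and
`‖p − c‖ < s`, the two dimension-one integral representations over `ℝ`
`r = [ℝ, Re(a·w′(t)/(w(t) − p))]`, `w(t) = c + s(1+ti)/(1−ti)` the Cayley parametrisation of the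
circle `|w − c| = s` (`w′(t) = 2is/(1−ti)²`), and `r′ = [ℝ, −2·Im a/(1+t²)]` are KZ-equivalent:
"`∮ dw/(w−p) = 2πi` inside the rules".

Proof. Both integrands are quotients of real polynomials in `t` with real-algebraic coefficients
(for `r`: `Re(N/D) = (Re N·Re D + Im N·Im D)/|D|²` with `N = 2isa`,
`D = (1−ti)((c−p)(1−ti)+s(1+ti))`, and `D ≠ 0` on `ℝ` because the circle misses `p`), so the
dimension-one kernel theorem with algebraic coefficients
`InverseLandau.kzPeriodConjecture_dim_one_algCoeff` reduces the claim to the equality of the two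
VALUES. `r′.value = −2·Im a·π` (`∫ dt/(1+t²) = π`); `r.value = Re(a·∮_{C(c,s)} dw/(w−p)) =
Re(a·2πi) = −2π·Im a` by the substitution `θ = 2·arctan t` (`e^{iθ} = (1+ti)/(1−ti)`,
`dθ = 2dt/(1+t²)`; one-dimensional change of variables
`integral_image_eq_integral_abs_deriv_smul`, periodicity of the circle integrand) and Cauchy's
integral `circleIntegral.integral_sub_inv_of_mem_ball`.
-/

noncomputable section

namespace Summit.KontsevichZagierPeriods.AttractorUnfolding

open MeasureTheory Set Complex
open Literature.NumberTheory.Transcendental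
open scoped Real

/-! ## The Cayley parametrisation of the circle -/

/-- `1 − ti ≠ 0` for real `t`. [folklore] -/
theorem pointResidue_one_sub_ne_zero (t : ℝ) : (1 : ℂ) - t * I ≠ 0 := fun h => by
  simpa using congrArg Complex.re h

/-- `1 + ti ≠ 0` for real `t`. [folklore] -/
theorem pointResidue_one_add_ne_zero (t : ℝ) : (1 : ℂ) + t * I ≠ 0 := fun h => by
  simpa using congrArg Complex.re h

/-- Half-angle chart: the circle point at angle `2·arctan t` is the Cayley point
`c + s(1+ti)/(1−ti)`. [folklore] -/
theorem circleMap_two_arctan (c : ℂ) (s t : ℝ) :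
    circleMap c s (2 * Real.arctan t) = c + s * (1 + t * I) / (1 - t * I) := by
  rw [circleMap, Literature.Analysis.Fourier.cexp_two_mul_arctan_mul_I, mul_div_assoc]
  congr 2
  ring

/-- The circle `|w − c| = s` misses every point `p` with `‖p − c‖ < s`. [folklore] -/
theorem circleMap_sub_ne_zero {c p : ℂ} {s : ℝ} (hps : ‖p - c‖ < s) (θ : ℝ) :
    circleMap c s θ - p ≠ 0 :=
  sub_ne_zero.2 (circleMap_ne_mem_ball (by rwa [Metric.mem_ball, dist_eq_norm]) θ)

/-- The Cayley point `c + s(1+ti)/(1−ti)` is never the interior point `p`. [folklore] -/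
theorem cayley_sub_ne_zero {c p : ℂ} {s : ℝ} (hps : ‖p - c‖ < s) (t : ℝ) :
    c + s * (1 + t * I) / (1 - t * I) - p ≠ 0 := by
  rw [← circleMap_two_arctan]
  exact circleMap_sub_ne_zero hps _

/-- The half-angle chart `t ↦ 2·arctan t` maps `ℝ` onto `(−π, π)`. [folklore] -/
theorem image_two_arctan : (fun t : ℝ => 2 * Real.arctan t) '' univ = Ioo (-π) π := by
  ext θ
  simp only [image_univ, mem_range, mem_Ioo]
  constructor
  · rintro ⟨u, rfl⟩
    constructor <;> nlinarith [Real.neg_pi_div_two_lt_arctan u, Real.arctan_lt_pi_div_two u]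
  · rintro ⟨h0, h2⟩
    refine ⟨Real.tan (θ / 2), ?_⟩
    rw [Real.arctan_tan (by linarith) (by linarith)]
    ring

/-- **`∫_ℝ a·w′(t)dt/(w(t) − p) = a·2πi`** for the Cayley parametrisation
`w(t) = c + s(1+ti)/(1−ti)` of the circle `|w − c| = s` and `‖p − c‖ < s`, with absolute
convergence: the substitution `θ = 2·arctan t` turns the integral into `∮_{C(c,s)} a dz/(z − p)`
(Cauchy). [folklore] -/
theorem integral_cayleyKernel {c p : ℂ} (a : ℂ) {s : ℝ} (hps : ‖p - c‖ < s) :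
    Integrable (fun t : ℝ =>
        a * (2 * I * s / (1 - t * I) ^ 2) / (c + s * (1 + t * I) / (1 - t * I) - p)) ∧
      ∫ t : ℝ, a * (2 * I * s / (1 - t * I) ^ 2) / (c + s * (1 + t * I) / (1 - t * I) - p) =
        a * (2 * π * I) := by
  have hpball : p ∈ Metric.ball c s := by rwa [Metric.mem_ball, dist_eq_norm]
  have hne : ∀ θ : ℝ, circleMap c s θ - p ≠ 0 := circleMap_sub_ne_zero hps
  set G : ℝ → ℂ := fun θ => (circleMap 0 s θ * I) • (a * (circleMap c s θ - p)⁻¹) with hG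
  have hcirc : ∫ θ in (0:ℝ)..2 * π, G θ = a * (2 * π * I) := by
    have h1 : (∮ z in C(c, s), a * (z - p)⁻¹) = a * (2 * π * I) := by
      rw [circleIntegral.integral_const_mul, circleIntegral.integral_sub_inv_of_mem_ball hpball]
    simpa only [circleIntegral, deriv_circleMap] using h1
  have hGc : Continuous G :=
    ((continuous_circleMap 0 s).mul continuous_const).smul
      (continuous_const.mul (((continuous_circleMap c s).sub continuous_const).inv₀ hne))
  have hGp : Function.Periodic G (2 * π) := fun θ => by
    simp only [hG, periodic_circleMap c s θ, periodic_circleMap 0 s θ]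
  have hper : ∫ θ in (-π:ℝ)..π, G θ = ∫ θ in (0:ℝ)..2 * π, G θ := by
    have := hGp.intervalIntegral_add_eq (-π) 0
    rwa [zero_add, show -π + 2 * π = π by ring] at this
  -- the half-angle chart
  have hderiv : ∀ t : ℝ, HasDerivAt (fun t : ℝ => 2 * Real.arctan t) (2 / (1 + t ^ 2)) t := fun t =>
    ((Real.hasDerivAt_arctan t).const_mul 2).congr_deriv (by ring)
  have hinj : InjOn (fun t : ℝ => 2 * Real.arctan t) univ := fun x _ y _ hxy =>
    Real.arctan_injective (mul_left_cancel₀ two_ne_zero hxy)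
  have hcov := integral_image_eq_integral_abs_deriv_smul MeasurableSet.univ
    (fun t _ => (hderiv t).hasDerivWithinAt) hinj G
  have hIcov := integrableOn_image_iff_integrableOn_abs_deriv_smul MeasurableSet.univ
    (fun t _ => (hderiv t).hasDerivWithinAt) hinj G
  rw [image_two_arctan, Measure.restrict_univ] at hcov
  rw [image_two_arctan, integrableOn_univ] at hIcov
  -- the pulled-back integrand is the Cayley kernel
  have hpt : ∀ t : ℝ, |2 / (1 + t ^ 2)| • G (2 * Real.arctan t) =
      a * (2 * I * s / (1 - t * I) ^ 2) / (c + s * (1 + t * I) / (1 - t * I) - p) := by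
    intro t
    have h1 := pointResidue_one_sub_ne_zero t
    have h2 := pointResidue_one_add_ne_zero t
    have key : ((2 / (1 + t ^ 2) : ℝ) : ℂ) * (s * (1 + t * I) / (1 - t * I) * I) =
        2 * I * s / (1 - t * I) ^ 2 := by
      have h3 : (1 : ℂ) + (t : ℂ) ^ 2 = (1 + t * I) * (1 - t * I) := by
        ring_nf
        rw [Complex.I_sq]
        ring
      push_cast
      rw [h3]
      field_simp
    rw [abs_of_pos (by positivity), hG]
    simp only [circleMap_two_arctan, Complex.real_smul, smul_eq_mul, zero_add]
    rw [← key]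
    ring
  have hGi : IntegrableOn G (Ioo (-π) π) := (hGc.integrableOn_Icc).mono_set Ioo_subset_Icc_self
  refine ⟨(hIcov.1 hGi).congr (ae_of_all _ hpt), ?_⟩
  calc ∫ t : ℝ, a * (2 * I * s / (1 - t * I) ^ 2) / (c + s * (1 + t * I) / (1 - t * I) - p)
        = ∫ t : ℝ, |2 / (1 + t ^ 2)| • G (2 * Real.arctan t) :=
          integral_congr_ae (ae_of_all _ fun t => (hpt t).symm)
    _ = ∫ θ in Ioo (-π) π, G θ := hcov.symm
    _ = ∫ θ in (-π:ℝ)..π, G θ := by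
          rw [intervalIntegral.integral_of_le (by linarith [Real.pi_pos]),
            integral_Ioc_eq_integral_Ioo]
    _ = a * (2 * π * I) := by rw [hper, hcirc]

/-! ## The algebraic-coefficient reading of the Cayley kernel -/

/-- **The real part of the Cayley kernel is a quotient of real polynomials with real-algebraic
coefficients, the denominator non-vanishing on `ℝ`**: `Re(N/D) = (Re N·Re D + Im N·Im D)/|D|²`
with `N = 2isa`, `D = (1 − ti)((c − p)(1 − ti) + s(1 + ti)) ≠ 0` (the circle misses `p`); the
coefficients are polynomials in `Re/Im` of `a, c, p` and `s`, computed in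
`K = algebraicClosure ℚ ℝ`. [folklore] -/
theorem exists_reading_cayleyKernel {c p a : ℂ} {s : ℝ} (hc₁ : IsAlgebraic ℚ c.re)
    (hc₂ : IsAlgebraic ℚ c.im) (hp₁ : IsAlgebraic ℚ p.re) (hp₂ : IsAlgebraic ℚ p.im)
    (ha₁ : IsAlgebraic ℚ a.re) (ha₂ : IsAlgebraic ℚ a.im) (hs : IsAlgebraic ℚ s)
    (hps : ‖p - c‖ < s) :
    ∃ P Q : Polynomial ℝ, (∀ i, IsAlgebraic ℚ (P.coeff i)) ∧ (∀ i, IsAlgebraic ℚ (Q.coeff i)) ∧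
      (∀ t : ℝ, Q.eval t ≠ 0) ∧
      ∀ t : ℝ, (a * (2 * I * s / (1 - t * I) ^ 2) / (c + s * (1 + t * I) / (1 - t * I) - p)).re =
        P.eval t / Q.eval t := by
  -- the algebraic data as elements of `K = algebraicClosure ℚ ℝ`
  obtain ⟨dr, edr⟩ : ∃ x : algebraicClosure ℚ ℝ, (x : ℝ) = c.re - p.re :=
    ⟨⟨_, mem_algebraicClosure_iff.2 (hc₁.sub hp₁)⟩, rfl⟩
  obtain ⟨di, edi⟩ : ∃ x : algebraicClosure ℚ ℝ, (x : ℝ) = c.im - p.im :=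
    ⟨⟨_, mem_algebraicClosure_iff.2 (hc₂.sub hp₂)⟩, rfl⟩
  obtain ⟨ar, ear⟩ : ∃ x : algebraicClosure ℚ ℝ, (x : ℝ) = a.re :=
    ⟨⟨_, mem_algebraicClosure_iff.2 ha₁⟩, rfl⟩
  obtain ⟨ai, eai⟩ : ∃ x : algebraicClosure ℚ ℝ, (x : ℝ) = a.im :=
    ⟨⟨_, mem_algebraicClosure_iff.2 ha₂⟩, rfl⟩
  obtain ⟨s', es⟩ : ∃ x : algebraicClosure ℚ ℝ, (x : ℝ) = s :=
    ⟨⟨_, mem_algebraicClosure_iff.2 hs⟩, rfl⟩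
  -- real and imaginary parts of `D`, numerator and denominator, over `K`
  set Dre : Polynomial (algebraicClosure ℚ ℝ) := Polynomial.C (dr + s') +
    Polynomial.C (2 * di) * Polynomial.X + Polynomial.C (s' - dr) * Polynomial.X ^ 2 with hDre
  set Dim : Polynomial (algebraicClosure ℚ ℝ) := Polynomial.C di -
    Polynomial.C (2 * dr) * Polynomial.X - Polynomial.C di * Polynomial.X ^ 2 with hDim
  set PK : Polynomial (algebraicClosure ℚ ℝ) :=
    Polynomial.C (-2 * s' * ai) * Dre + Polynomial.C (2 * s' * ar) * Dim with hPK
  set QK : Polynomial (algebraicClosure ℚ ℝ) := Dre * Dre + Dim * Dim with hQK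
  have hDre_ev : ∀ t : ℝ, (Polynomial.aeval t Dre : ℝ) =
      ((1 - t * I) * ((c - p) * (1 - t * I) + s * (1 + t * I))).re := by
    intro t
    simp only [hDre, map_add, map_mul, map_pow, map_sub, map_ofNat, Polynomial.aeval_C,
      Polynomial.aeval_X, IntermediateField.algebraMap_apply]
    rw [edr, edi, es]
    simp only [Complex.mul_re, Complex.mul_im, Complex.add_re, Complex.add_im, Complex.sub_re,
      Complex.sub_im, Complex.one_re, Complex.one_im, Complex.ofReal_re, Complex.ofReal_im,
      Complex.I_re, Complex.I_im]
    ring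
  have hDim_ev : ∀ t : ℝ, (Polynomial.aeval t Dim : ℝ) =
      ((1 - t * I) * ((c - p) * (1 - t * I) + s * (1 + t * I))).im := by
    intro t
    simp only [hDim, map_sub, map_mul, map_pow, map_ofNat, Polynomial.aeval_C,
      Polynomial.aeval_X, IntermediateField.algebraMap_apply]
    rw [edr, edi]
    simp only [Complex.mul_re, Complex.mul_im, Complex.add_re, Complex.add_im, Complex.sub_re,
      Complex.sub_im, Complex.one_re, Complex.one_im, Complex.ofReal_re, Complex.ofReal_im,
      Complex.I_re, Complex.I_im]
    ring
  have hPev : ∀ t : ℝ, (PK.map (algebraMap _ ℝ)).eval t =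
      (2 * I * s * a).re * ((1 - t * I) * ((c - p) * (1 - t * I) + s * (1 + t * I))).re +
      (2 * I * s * a).im * ((1 - t * I) * ((c - p) * (1 - t * I) + s * (1 + t * I))).im := by
    intro t
    rw [Polynomial.eval_map_algebraMap, hPK]
    simp only [map_add, map_mul, map_neg, map_ofNat, Polynomial.aeval_C,
      IntermediateField.algebraMap_apply, hDre_ev, hDim_ev]
    rw [ear, eai, es]
    simp only [Complex.mul_re, Complex.mul_im, Complex.ofReal_re, Complex.ofReal_im,
      Complex.I_re, Complex.I_im, Complex.re_ofNat, Complex.im_ofNat]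
    ring
  have hQev : ∀ t : ℝ, (QK.map (algebraMap _ ℝ)).eval t =
      Complex.normSq ((1 - t * I) * ((c - p) * (1 - t * I) + s * (1 + t * I))) := by
    intro t
    rw [Polynomial.eval_map_algebraMap, hQK, map_add, map_mul, map_mul, hDre_ev, hDim_ev,
      Complex.normSq_apply]
  have e : ∀ t : ℝ, (c - p) * (1 - t * I) + s * (1 + t * I) =
      (1 - t * I) * (c + s * (1 + t * I) / (1 - t * I) - p) := fun t => by
    have h1 := pointResidue_one_sub_ne_zero t
    field_simp
    ring
  have hD : ∀ t : ℝ, (1 - t * I) * ((c - p) * (1 - t * I) + s * (1 + t * I)) ≠ 0 := fun t => by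
    rw [e]
    have h1 := pointResidue_one_sub_ne_zero t
    exact mul_ne_zero h1 (mul_ne_zero h1 (cayley_sub_ne_zero hps t))
  refine ⟨PK.map (algebraMap _ ℝ), QK.map (algebraMap _ ℝ), fun i => ?_, fun i => ?_, fun t => ?_,
    fun t => ?_⟩
  · rw [Polynomial.coeff_map]
    exact mem_algebraicClosure_iff.1 (PK.coeff i).2
  · rw [Polynomial.coeff_map]
    exact mem_algebraicClosure_iff.1 (QK.coeff i).2
  · rw [hQev]
    exact (Complex.normSq_pos.2 (hD t)).ne'
  · have hcx : a * (2 * I * s / (1 - t * I) ^ 2) / (c + s * (1 + t * I) / (1 - t * I) - p) =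
        (2 * I * s * a) / ((1 - t * I) * ((c - p) * (1 - t * I) + s * (1 + t * I))) := by
      rw [e, mul_div_assoc', div_div]
      congr 1 <;> ring
    rw [hcx, Complex.div_re, ← add_div, hPev, hQev]

/-! ## The item -/

/-- **`PointResidue`** (route AttractorUnfolding, stmt-KontsevichZagierPeriods-11364): for
`c, p, a ∈ ℂ` and `s ∈ ℝ` with algebraic real/imaginary parts and `‖p − c‖ < s`, the representations
`[ℝ, Re(a·w′(t)/(w(t) − p))]` (`w(t) = c + s(1+ti)/(1−ti)`) and `[ℝ, −2·Im a/(1+t²)]` are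
KZ-equivalent — "`∮ dw/(w−p) = 2πi` inside the rules". Proof: both integrands are quotients of real
polynomials with real-algebraic coefficients (`exists_reading_cayleyKernel`), both values are
`−2π·Im a` (`integral_cayleyKernel`: Cauchy's integral after `θ = 2·arctan t`; `∫ dt/(1+t²) = π`),
and the dimension-one kernel theorem with algebraic coefficients
`InverseLandau.kzPeriodConjecture_dim_one_algCoeff` (Baker) concludes.
[cite: KontsevichZagier2001, §1.2] -/
theorem pointResidue_proof :
    Summit.KontsevichZagierPeriods.KontsevichZagierPeriods.Theses.AttractorUnfolding.PointResidue := by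
  intro c p a s r r' hc₁ hc₂ hp₁ hp₂ ha₁ ha₂ hs hps hdom hdom' hint hint'
  obtain ⟨P, Q, hP, hQ, hQ0, hPQ⟩ := exists_reading_cayleyKernel hc₁ hc₂ hp₁ hp₂ ha₁ ha₂ hs hps
  -- the reading of `r'`
  obtain ⟨ai, eai⟩ : ∃ x : algebraicClosure ℚ ℝ, (x : ℝ) = a.im :=
    ⟨⟨_, mem_algebraicClosure_iff.2 ha₂⟩, rfl⟩
  set P' : Polynomial (algebraicClosure ℚ ℝ) := -2 * Polynomial.C ai with hP'
  set Q' : Polynomial (algebraicClosure ℚ ℝ) := 1 + Polynomial.X ^ 2 with hQ'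
  have hP'ev : ∀ t : ℝ, (P'.map (algebraMap _ ℝ)).eval t = -2 * a.im := fun t => by
    rw [Polynomial.eval_map_algebraMap, hP', map_mul, map_neg, map_ofNat, Polynomial.aeval_C,
      IntermediateField.algebraMap_apply, eai]
  have hQ'ev : ∀ t : ℝ, (Q'.map (algebraMap _ ℝ)).eval t = 1 + t ^ 2 := fun t => by
    rw [Polynomial.eval_map_algebraMap, hQ', map_add, map_one, map_pow, Polynomial.aeval_X]
  -- the two values
  have hH := integral_cayleyKernel a hps
  have hrv : r.value = -(2 * π * a.im) := by
    have hF : r.integrand = fun z => (a * (2 * I * s / (1 - (z 0 : ℂ) * I) ^ 2) /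
        (c + s * (1 + (z 0 : ℂ) * I) / (1 - (z 0 : ℂ) * I) - p)).re :=
      funext fun z => hint (by rw [hdom]; exact mem_univ _)
    have e1 := (volume_preserving_funUnique (Fin 1) ℝ).integral_comp'
      (fun t : ℝ =>
        (a * (2 * I * s / (1 - t * I) ^ 2) / (c + s * (1 + t * I) / (1 - t * I) - p)).re)
    have e2 := integral_re hH.1
    simp only [RCLike.re_to_complex] at e2
    rw [KZ.IntegralRep.value, hdom, Measure.restrict_univ, hF]
    refine e1.trans ?_
    rw [e2, hH.2]
    simp only [Complex.mul_re, Complex.mul_im, Complex.ofReal_re, Complex.ofReal_im, Complex.I_re,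
      Complex.I_im, Complex.re_ofNat, Complex.im_ofNat]
    ring
  have hrv' : r'.value = -(2 * π * a.im) := by
    have hF' : r'.integrand = fun z => -2 * a.im / (1 + z 0 ^ 2) :=
      funext fun z => hint' (by rw [hdom']; exact mem_univ _)
    have e1 := (volume_preserving_funUnique (Fin 1) ℝ).integral_comp'
      (fun t : ℝ => -2 * a.im / (1 + t ^ 2))
    rw [KZ.IntegralRep.value, hdom', Measure.restrict_univ, hF']
    refine e1.trans ?_
    simp only [div_eq_mul_inv]
    rw [integral_const_mul, integral_univ_inv_one_add_sq]
    ring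
  -- the dimension-one kernel theorem with algebraic coefficients
  refine InverseLandau.kzPeriodConjecture_dim_one_algCoeff r r' P Q (P'.map (algebraMap _ ℝ))
    (Q'.map (algebraMap _ ℝ)) hP hQ (fun x _ => hQ0 (x 0)) (fun x hx => ?_) (fun i => ?_)
    (fun i => ?_) (fun x _ => ?_) (fun x hx => ?_) (hrv.trans hrv'.symm)
  · rw [hint hx]
    exact hPQ (x 0)
  · rw [Polynomial.coeff_map]
    exact mem_algebraicClosure_iff.1 (P'.coeff i).2
  · rw [Polynomial.coeff_map]
    exact mem_algebraicClosure_iff.1 (Q'.coeff i).2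
  · rw [hQ'ev]
    positivity
  · rw [hint' hx]
    simp only [hP'ev, hQ'ev]

end Summit.KontsevichZagierPeriods.AttractorUnfolding

end
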